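import Mathlib
import HarnessLib
import Summits.AtomisticToContinuum.FouriersLaw.Theses.JunctionLocality
import Summits.AtomisticToContinuum.FouriersLaw.Theses.BoundaryEscapeDeficit
import Summits.AtomisticToContinuum.FouriersLaw.Theorems.JunctionLocalitySuperadditiveResistanceDeviceLiouville
import Summits.AtomisticToContinuum.FouriersLaw.Theorems.JunctionLocalitySuperadditiveResistancePlainAdjoint
import Summits.AtomisticToContinuum.FouriersLaw.Theorems.BoundaryEscapeDeficitBoundaryKernelBasics
import Summits.AtomisticToContinuum.FouriersLaw.Theorems.JunctionLocalitySuperadditiveResistanceStubPlainForwardFieldAux1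
import Summits.AtomisticToContinuum.FouriersLaw.Theorems.JunctionLocalitySuperadditiveResistanceStubPlainForwardFieldAux3
import Summits.AtomisticToContinuum.FouriersLaw.Theorems.JunctionLocalitySuperadditiveResistanceStubPlainKuboLinkAux2

/-!
# Kubo link, helper III: the Green–Kubo identification of the plain chain's forward field, and the
Kubo link from `ResponseIdentity`
(stub `stub_plainKuboLink` of line `floating-probe-bypass-laplacian`, crux stmt-AtomisticToContinuum-11748)

For the pinned anharmonic chain `pinnedChain ω₂ lam β γ` (all parameters `> 0`), `L ≥ 1`, `T > 0`, the
Gibbs measure `μ_T`, the constructed transition kernels `P_u` at equal bath temperatures and the boundary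
kernel `K_L(u) = ⟨p_0² − T, P_u(p_0² − T)⟩_{μ_T}` of route `BoundaryEscapeDeficit`:

* `plainForwardField_unique'` — two classical mean-zero `C² ∩ L²(μ_T)` solutions of
  `L_{T,T} g = −(p_s² − T)` coincide (the landed `L²(μ_T)`-Liouville theorem
  `eq_zero_of_liouville_pinnedChain`);
* `exists_forwardField_pairing` — the semigroup forward field: a smooth, mean-zero `g ∈ L²(μ_T)` with
  `L_{T,T} g = −(p_0² − T)` pointwise AND `∫ g (p_0² − T) dμ_T = ∫_{u>0} K_L(u) du` (the Poisson field
  `∫_{u>0} P_u(p_0² − T) du` of helper II; its distributional Poisson equation and hypoelliptic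
  regularity from the sibling stub's helpers `…StubPlainForwardFieldAux1/3`; the pairing by Fubini,
  `integral_mul_poissonField`);
* `greenKubo_forwardField` (registered sub-goal `helper_plainKuboGreenKubo`) — hence for EVERY classical
  forward field `g` of the left bath: `⟨g, p_0² − T⟩_{μ_T} = ∫₀^∞ K_L(u) du`, i.e. the line's Kubo
  conductance `plainKubo g = γ(1 − (γ/T²)⟨g, p_0² − T⟩)` equals `γ E_L`, `E_L` the escape deficit;
* `kuboLink_of_responseIdentity` (registered sub-goal `helper_plainKuboLinkOfResponseIdentity`) — the
  registered stub `stub_plainKuboLink` (with its Set-valued vocabulary unfolded) follows from the open route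
  item `BoundaryEscapeDeficit.ResponseIdentity` (stmt-AtomisticToContinuum-12237: `D_L = (L−1)·γ·E_L` along
  unique weak steady-state families), by uniqueness of limits along `𝓝[≠] 0`.

So the NESS content of the Kubo link is exactly item 12237 (finite-volume linear response of the unique
weak NESS: energy balance `totalCurrent = (L−1)γ(T_L − ⟨p_0²⟩)` plus `δ`-differentiability of `⟨p_0²⟩_δ`);
everything on the equilibrium side is proved here.
-/

noncomputable section

open MeasureTheory Filter Topology Set ProbabilityTheory
open scoped ContDiff NNReal ENNReal
open Literature.MathematicalPhysics.KineticTheory.HeatConduction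
open Literature.MathematicalPhysics.KineticTheory Literature.Probability.Process OscillatorChain
open Literature.Analysis.Distribution
open Summit.AtomisticToContinuum.FouriersLaw.Theorems.SubdiffusiveBondHeat
open Summit.AtomisticToContinuum.FouriersLaw.Theorems.SuperadditiveResistance.PlainForwardField
open Summit.AtomisticToContinuum.FouriersLaw.Theorems.SuperadditiveResistance.DeviceLiouville
  (kin deviceGenerator liouvilleOp bathOp generator_eq_liouvilleOp_add liouvilleOp_sub bathOp_sub
    eq_zero_of_liouville_pinnedChain kin_eq_sq)

namespace Summit.AtomisticToContinuum.FouriersLaw.Cruxes.SuperadditiveResistance.FloatingProbeBypassLaplacian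

/-! ## Uniqueness of the plain chain's forward fields -/

/-- **Uniqueness of classical forward fields of the plain chain**: two `C²`, `L²(μ_T)`, mean-zero
classical solutions of `L_{T,T} g = −(p_s² − T)` coincide (`ω₂ > 0`, `lam, β ≥ 0`, `γ, T > 0`, `L ≥ 1`):
their difference solves `X_H w + γ S w = 0`, hence vanishes by the landed `L²(μ_T)`-Liouville theorem. -/
theorem plainForwardField_unique' {ω₂ lam β : ℝ} (hω : 0 < ω₂) (hl : 0 ≤ lam) (hβ : 0 ≤ β) {γ : ℝ}
    (hγ : 0 < γ) {L : ℕ} (hL : 0 < L) {T : ℝ} (hT : 0 < T) (s : ℕ) {g g' : PhaseSpace L → ℝ}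
    (hC : ContDiff ℝ 2 g) (hL2 : MemLp g 2 ((pinnedChain ω₂ lam β γ).gibbsMeasure L T))
    (hmean : ∫ x, g x ∂((pinnedChain ω₂ lam β γ).gibbsMeasure L T) = 0)
    (hpde : ∀ x, (pinnedChain ω₂ lam β γ).generator L T T g x = -(kin L s x - T))
    (hC' : ContDiff ℝ 2 g') (hL2' : MemLp g' 2 ((pinnedChain ω₂ lam β γ).gibbsMeasure L T))
    (hmean' : ∫ x, g' x ∂((pinnedChain ω₂ lam β γ).gibbsMeasure L T) = 0)
    (hpde' : ∀ x, (pinnedChain ω₂ lam β γ).generator L T T g' x = -(kin L s x - T)) :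
    g = g' := by
  set P := pinnedChain ω₂ lam β γ with hP
  haveI := pinnedChain_isProbabilityMeasure_gibbsMeasure hω hl hβ γ L hT
  have hwC : ContDiff ℝ 2 (fun y => g y - g' y) := hC.sub hC'
  have hwL2 : MemLp (fun y => g y - g' y) 2 (P.gibbsMeasure L T) := hL2.sub hL2'
  have hwmean : ∫ x, (fun y => g y - g' y) x ∂(P.gibbsMeasure L T) = 0 := by
    simp only
    rw [integral_sub (hL2.integrable one_le_two) (hL2'.integrable one_le_two), hmean, hmean', sub_zero]
  have hγ' : P.γ = γ := rfl
  have hwpde : ∀ x, 1 * liouvilleOp P L (fun y => g y - g' y) x +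
      γ * bathOp L (OscillatorChain.bathWeight L) T (fun y => g y - g' y) x = 0 := by
    intro x
    have e := hpde x
    have e' := hpde' x
    rw [generator_eq_liouvilleOp_add, hγ'] at e e'
    rw [one_mul, liouvilleOp_sub (hC.differentiable two_ne_zero) (hC'.differentiable two_ne_zero),
      bathOp_sub hC hC']
    linear_combination e - e'
  have hB : ∀ i, 0 ≤ OscillatorChain.bathWeight L i := fun i => by
    unfold OscillatorChain.bathWeight
    split_ifs <;> norm_num
  have hB0 : 0 < OscillatorChain.bathWeight L ⟨0, hL⟩ := by
    unfold OscillatorChain.bathWeight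
    simp only [if_true]
    split_ifs <;> norm_num
  have hzero := eq_zero_of_liouville_pinnedChain hω hl hβ γ hL hT (OscillatorChain.bathWeight L) hB hB0
    one_ne_zero hγ hwC hwL2 hwpde hwmean
  funext y
  exact sub_eq_zero.mp (hzero y)

/-! ## The semigroup forward field and its Green–Kubo pairing -/

section SemigroupField

variable {ω₂ lam β γ : ℝ} (hω : 0 < ω₂) (hl : 0 ≤ lam) (hβ : 0 < β) (hγ : 0 < γ) {L : ℕ} (hL : 0 < L)
  {T : ℝ} (hT : 0 < T)
include hω hl hβ hγ hL hT

/-- **The semigroup forward field of the left bath and its Green–Kubo pairing.** There is a smooth,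
mean-zero `g ∈ L²(μ_T)` with `L_{T,T} g = −(p_0² − T)` pointwise and
`∫ g·(p_0² − T) dμ_T = ∫_{u>0} K_L(u) du`: `g` is the smooth representative (Hörmander) of the Poisson
field `G = ∫_{u>0} P_u(p_0² − T) du` of helper II, which solves `L G = −(p_0² − T)` in `𝓓'`
(`integral_transpose_mul_forwardIntegral`) and pairs with `p_0² − T` by Fubini. -/
theorem exists_forwardField_pairing :
    ∃ g : PhaseSpace L → ℝ, ContDiff ℝ ∞ g ∧ MemLp g 2 ((pinnedChain ω₂ lam β γ).gibbsMeasure L T) ∧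
      ∫ x, g x ∂((pinnedChain ω₂ lam β γ).gibbsMeasure L T) = 0 ∧
      (∀ x, (pinnedChain ω₂ lam β γ).generator L T T g x = -(x.2 ⟨0, hL⟩ ^ 2 - T)) ∧
      ∫ x, g x * (x.2 ⟨0, hL⟩ ^ 2 - T) ∂((pinnedChain ω₂ lam β γ).gibbsMeasure L T) =
        ∫ u in Ioi (0 : ℝ), ∫ z, (z.2 ⟨0, hL⟩ ^ 2 - T) *
          (∫ y, (y.2 ⟨0, hL⟩ ^ 2 - T) ∂((pinnedChain ω₂ lam β γ).transitionKernel L T T u.toNNReal z))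
          ∂((pinnedChain ω₂ lam β γ).gibbsMeasure L T) := by
  haveI := isAddHaarMeasure_volume_phaseSpace L
  set P := pinnedChain ω₂ lam β γ with hP
  set μ := P.gibbsMeasure L T with hμ
  haveI : IsProbabilityMeasure μ := pinnedChain_isProbabilityMeasure_gibbsMeasure hω hl hβ.le γ L hT
  have hU : ContDiff ℝ ∞ P.U := pinnedChain_contDiff_U ω₂ lam β γ
  have hV : ContDiff ℝ ∞ P.V := pinnedChain_contDiff_V ω₂ lam β γ
  have hγ' : P.γ = γ := rfl
  have hγT : 0 ≤ P.γ * T := by rw [hγ']; positivity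
  -- the weight `ϑ = 1/(4T)` and the observable `k = p_0² − T`
  set ϑ : ℝ := 1 / (4 * T) with hϑ
  have hϑ0 : 0 < ϑ := by positivity
  have hϑ1 : ϑ < 1 / T := by rw [hϑ, div_lt_div_iff₀ (by positivity) hT]; nlinarith
  have h2ϑ : 2 * ϑ < 1 / T := by
    rw [hϑ, show 2 * (1 / (4 * T)) = 1 / (2 * T) by field_simp; ring, div_lt_div_iff₀ (by positivity) hT]
    nlinarith
  have hϑϑ : ϑ + ϑ < 1 / T := by linarith
  set M : ℝ := 2 / ϑ + T with hM
  have hM0 : 0 < M := by positivity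
  set k : PhaseSpace L → ℝ := fun y => y.2 ⟨0, hL⟩ ^ 2 - T with hk
  have hks : ContDiff ℝ ∞ k := by rw [hk]; fun_prop
  have hkc : Continuous k := hks.continuous
  have hkb : ∀ y, |k y| ≤ M * Real.exp (ϑ * P.hamiltonian L y) := fun y =>
    abs_sq_momentum_sub_le_exp hω hl hβ.le hϑ0 hT.le y ⟨0, hL⟩
  have hk0 : ∫ y, k y ∂μ = 0 := pinnedChain_integral_kinObs_gibbsMeasure hω hl hβ.le γ L hT ⟨0, hL⟩
  -- the Poisson field of helper II and its properties
  set G : PhaseSpace L → ℝ := poissonField ω₂ lam β γ T L k with hG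
  have hGm : StronglyMeasurable G := stronglyMeasurable_poissonField hω hl hβ.le hγ.le hkc
  obtain ⟨C, hC, hGb⟩ := abs_poissonField_le hω hl hβ hγ hL hT hϑ0 hϑ1
  have hGb' : ∀ x, |G x| ≤ M * C * Real.exp (ϑ * P.hamiltonian L x) := fun x => hGb M hM0 k hkc hkb x
  have hGL2 : MemLp G 2 μ := memLp_poissonField hω hl hβ hγ hL hT hϑ0 h2ϑ hM0 hkc hkb
  have hGmean : ∫ x, G x ∂μ = 0 := integral_poissonField hω hl hβ hγ hL hT hϑ0 hϑ1 hM0 hkc hkb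
  have hGpair : ∫ x, k x * G x ∂μ = ∫ u in Ioi (0 : ℝ), ∫ z, k z *
      (∫ y, k y ∂(P.transitionKernel L T T u.toNNReal z)) ∂μ := by
    obtain ⟨-, h2⟩ := integral_mul_poissonField hω hl hβ hγ hL hT hϑ0 hϑ0.le hϑϑ hM0 hkc hkb hkc hkb
    rw [h2]
    refine integral_congr_ae (ae_of_all _ fun u => ?_)
    refine integral_congr_ae (ae_of_all _ fun z => ?_)
    dsimp only
    rw [actCentered_apply, hk0, sub_zero]
  -- `G` as the forward integral of the sibling development (no centring needed: `μ_T(k) = 0`)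
  have hGeq : G = fun x => ∫ t in Ioi (0 : ℝ), ∫ y, k y ∂(P.langevinKernel L T T t.toNNReal x) := by
    funext x
    simp only [hG, poissonField_apply]
    refine integral_congr_ae (ae_of_all _ fun t => ?_)
    dsimp only
    rw [actCentered_apply, hk0, sub_zero, pinnedChain_langevinKernel_eq_transitionKernel L T T hω hl hβ.le hγ.le]
  -- decay of `P_t k` through the model-free kernels
  obtain ⟨C₁, c, -, hc, hdec⟩ := abs_actCentered_le hω hl hβ hγ hL hT hϑ0 hϑ1
  have hdecay : ∀ (t : ℝ≥0) (z : PhaseSpace L), |∫ y, k y ∂(P.langevinKernel L T T t z)| ≤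
      M * C₁ * Real.exp (ϑ * P.hamiltonian L z) * Real.exp (-c * t) := by
    intro t z
    have h := hdec M hM0 k hkc hkb z t
    rw [actCentered_apply, hk0, sub_zero, Real.toNNReal_coe] at h
    rwa [pinnedChain_langevinKernel_eq_transitionKernel L T T hω hl hβ.le hγ.le]
  -- local integrability of `G`
  set B : PhaseSpace L → ℝ := fun x => M * C * Real.exp (ϑ * P.hamiltonian L x) with hB
  have hBc : Continuous B := by
    have := pinnedChain_continuous_hamiltonian ω₂ lam β γ L
    rw [hB]; fun_prop
  have hGB : ∀ x, ‖G x‖ ≤ ‖B x‖ := fun x => by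
    rw [Real.norm_eq_abs, Real.norm_eq_abs]
    exact (hGb' x).trans (le_abs_self _)
  have hGloc : LocallyIntegrable G volume :=
    hBc.locallyIntegrable.mono hGm.aestronglyMeasurable (Eventually.of_forall hGB)
  -- the Poisson equation in `𝓓'`
  have hweak₀ : ∀ φ : PhaseSpace L → ℝ, ContDiff ℝ ∞ φ → HasCompactSupport φ →
      ∫ x, G x * hormanderTranspose (P.drift L) (P.bathField hL T T) (fun _ => 0) φ x =
        ∫ x, (-k x) * φ x := by
    intro φ hφ hφc
    have h := integral_transpose_mul_forwardIntegral hω hl hβ.le hγ.le hL hT hϑ0 hϑ1 hc hks hkb hdecay hφ hφc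
    have hGx : ∀ x, G x = ∫ t in Ioi (0 : ℝ), ∫ y, k y ∂(P.langevinKernel L T T t.toNNReal x) :=
      fun x => congrFun hGeq x
    calc ∫ x, G x * hormanderTranspose (P.drift L) (P.bathField hL T T) (fun _ => 0) φ x
        = ∫ x, (sdeGenerator (fun y => -P.drift L y) (P.bathVecL L T) (P.bathVecR L T) φ x +
            2 * γ * φ x) * ∫ t in Ioi (0 : ℝ), ∫ y, k y ∂(P.langevinKernel L T T t.toNNReal x) := by
          refine integral_congr_ae (ae_of_all _ fun x => ?_)
          dsimp only
          rw [hormanderTranspose_generatorFamily_eq_revGenerator P hU hV hL hγT hγT hφ x, hγ', mul_comm,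
            hGx x]
      _ = -∫ x, φ x * k x := h
      _ = ∫ x, (-k x) * φ x := by
          rw [← integral_neg]
          exact integral_congr_ae (ae_of_all _ fun x => by ring)
  -- hypoelliptic regularity and the classical equation
  obtain ⟨g, hg, hae⟩ := exists_smooth_ae_eq_of_weak_poisson hβ.le hγ hL hT hGloc hks.neg hweak₀
  have hweak : ∀ φ : PhaseSpace L → ℝ, ContDiff ℝ ∞ φ → HasCompactSupport φ →
      ∫ x, g x * hormanderTranspose (P.drift L) (P.bathField hL T T) (fun _ => 0) φ x =
        ∫ x, (-k x) * φ x := by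
    intro φ hφ hφc
    rw [← hweak₀ φ hφ hφc]
    refine integral_congr_ae ?_
    filter_upwards [hae] with x hx
    rw [hx]
  have hclass : ∀ x, P.generator L T T g x = -k x :=
    generator_eq_of_weak_poisson P hU hV hL hγT hγT hg hkc.neg hweak
  -- transfer of the `μ_T`-properties along `G =ᵐ g`
  have haeμ : G =ᵐ[μ] g := (P.gibbsMeasure_absolutelyContinuous L T).ae_le hae
  have hgL2 : MemLp g 2 μ := (memLp_congr_ae haeμ).1 hGL2
  have hgmean : ∫ x, g x ∂μ = 0 := by rw [← integral_congr_ae haeμ]; exact hGmean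
  have hgpair : ∫ x, g x * k x ∂μ = ∫ u in Ioi (0 : ℝ), ∫ z, k z *
      (∫ y, k y ∂(P.transitionKernel L T T u.toNNReal z)) ∂μ := by
    rw [← hGpair]
    refine integral_congr_ae ?_
    filter_upwards [haeμ] with x hx
    rw [← hx, mul_comm]
  exact ⟨g, hg, hgL2, hgmean, hclass, hgpair⟩

/-- **Green–Kubo identification of the plain chain's forward field.** For EVERY classical mean-zero
`C² ∩ L²(μ_T)` solution `g` of `L_{T,T} g = −(p_0² − T)`:
`∫ g (p_0² − T) dμ_T = ∫_{u>0} K_L(u) du` (uniqueness of forward fields + the semigroup field). -/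
theorem greenKubo_forwardField {g : PhaseSpace L → ℝ} (hC : ContDiff ℝ 2 g)
    (hL2 : MemLp g 2 ((pinnedChain ω₂ lam β γ).gibbsMeasure L T))
    (hmean : ∫ x, g x ∂((pinnedChain ω₂ lam β γ).gibbsMeasure L T) = 0)
    (hpde : ∀ x, (pinnedChain ω₂ lam β γ).generator L T T g x = -(kin L 0 x - T)) :
    ∫ x, g x * (kin L 0 x - T) ∂((pinnedChain ω₂ lam β γ).gibbsMeasure L T) =
      ∫ u in Ioi (0 : ℝ), ∫ z, (z.2 ⟨0, hL⟩ ^ 2 - T) *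
        (∫ y, (y.2 ⟨0, hL⟩ ^ 2 - T) ∂((pinnedChain ω₂ lam β γ).transitionKernel L T T u.toNNReal z))
        ∂((pinnedChain ω₂ lam β γ).gibbsMeasure L T) := by
  obtain ⟨g', hg', hL2', hmean', hpde', hpair'⟩ := exists_forwardField_pairing hω hl hβ hγ hL hT
  have hpde'' : ∀ x, (pinnedChain ω₂ lam β γ).generator L T T g' x = -(kin L 0 x - T) := fun x => by
    rw [hpde' x, kin_eq_sq hL]
  have heq : g = g' := plainForwardField_unique' hω hl hβ.le hγ hL hT 0 hC hL2 hmean hpde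
    (hg'.of_le (by norm_cast)) hL2' hmean' hpde''
  subst heq
  rw [← hpair']
  refine integral_congr_ae (ae_of_all _ fun x => ?_)
  dsimp only
  rw [kin_eq_sq hL]

end SemigroupField

/-! ## The Kubo link from `ResponseIdentity` -/

/-- **The Kubo link from `ResponseIdentity`** (the registered stub `stub_plainKuboLink` of the line with its
Set-valued vocabulary `plainForwardFields`, `plainKubo` unfolded): along the crux's unique weak steady-state
family, for `L ≥ 2` and every classical mean-zero `C² ∩ L²(μ_T)` forward field `g` of the left bath,
`D_L/(L−1) = γ(1 − (γ/T²)⟨g, p_0² − T⟩_{μ_T})` — GIVEN the route item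
`BoundaryEscapeDeficit.ResponseIdentity` (stmt-AtomisticToContinuum-12237:
`totalCurrent(μ_{L,T+δ/2,T−δ/2})/δ → (L−1)·γ·E_L`). Both are limits of the same difference quotient along
the non-trivial filter `𝓝[≠] 0`, so `D_L = (L−1)·γ·E_L`, and `⟨g, p_0² − T⟩ = ∫₀^∞ K_L` by
`greenKubo_forwardField`. -/
theorem kuboLink_of_responseIdentity
    (hRI : Summit.AtomisticToContinuum.FouriersLaw.Theses.BoundaryEscapeDeficit.ResponseIdentity) :
    ∀ (ω₂ lam β γ : ℝ) (μ : (N : ℕ) → ℝ → ℝ → Measure (PhaseSpace N)) (T : ℝ) (D : ℕ → ℝ),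
      0 < ω₂ → 0 < lam → 0 < β → 0 < γ → 0 < T →
      (∀ (N : ℕ) (T_L T_R : ℝ), 0 < T_L → 0 < T_R → ∀ ρ ρ' : Measure (PhaseSpace N),
        (pinnedChain ω₂ lam β γ).IsSteadyState N T_L T_R ρ →
        (pinnedChain ω₂ lam β γ).IsSteadyState N T_L T_R ρ' → ρ = ρ') →
      (∀ (N : ℕ) (T_L T_R : ℝ), 0 < T_L → 0 < T_R →
        (pinnedChain ω₂ lam β γ).IsSteadyState N T_L T_R (μ N T_L T_R)) →
      (∀ N : ℕ, Tendsto (fun δ : ℝ =>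
        (pinnedChain ω₂ lam β γ).totalCurrent (μ N (T + δ / 2) (T - δ / 2)) / δ) (𝓝[≠] 0) (𝓝 (D N))) →
      (∀ N : ℕ, 2 ≤ N → 0 < D N) →
      ∀ L : ℕ, 2 ≤ L → ∀ g : PhaseSpace L → ℝ, ContDiff ℝ 2 g →
        MemLp g 2 ((pinnedChain ω₂ lam β γ).gibbsMeasure L T) →
        ∫ x, g x ∂((pinnedChain ω₂ lam β γ).gibbsMeasure L T) = 0 →
        (∀ x, (pinnedChain ω₂ lam β γ).generator L T T g x = -(kin L 0 x - T)) →
        D L / ((L : ℝ) - 1) =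
          γ * (1 - γ / T ^ 2 * ∫ x, g x * (kin L 0 x - T) ∂((pinnedChain ω₂ lam β γ).gibbsMeasure L T)) := by
  intro ω₂ lam β γ μ T D hω hl hβ hγ hT hU hμ hD _ L hL2 g hC hgL2 hmean hpde
  have hL : 0 < L := by omega
  -- `ResponseIdentity` for this family at this `L`
  have hri := hRI ω₂ lam β γ hω hl hβ hγ hU μ hμ T hT
  dsimp only at hri
  obtain ⟨-, hlim⟩ := hri L hL
  simp only [dif_pos hL] at hlim
  -- uniqueness of the limit along `𝓝[≠] 0`
  have hDL := tendsto_nhds_unique (hD L) hlim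
  rw [hDL, greenKubo_forwardField hω hl.le hβ hγ hL hT hC hgL2 hmean hpde]
  have hL1 : ((L : ℝ) - 1) ≠ 0 := by
    have : (2 : ℝ) ≤ (L : ℝ) := by exact_mod_cast hL2
    linarith
  field_simp

/-! ## Registered helper sub-goals -/

/-- Registered helper sub-goal `helper_plainKuboGreenKubo` (= `greenKubo_forwardField` in stub form): the
Green–Kubo identification `⟨g, p_0² − T⟩_{μ_T} = ∫₀^∞ K_L(u) du` for every classical forward field of the left
bath of the plain `L`-chain. -/
theorem helper_plainKuboGreenKubo : ∀ {ω₂ lam β γ : ℝ}, 0 < ω₂ → 0 ≤ lam → 0 < β → 0 < γ → ∀ {L : ℕ} (hL : 0 < L) {T : ℝ}, 0 < T → ∀ {g : PhaseSpace L → ℝ}, ContDiff ℝ 2 g → MemLp g 2 ((pinnedChain ω₂ lam β γ).gibbsMeasure L T) → ∫ x, g x ∂((pinnedChain ω₂ lam β γ).gibbsMeasure L T) = 0 → (∀ x, (pinnedChain ω₂ lam β γ).generator L T T g x = -(kin L 0 x - T)) → ∫ x, g x * (kin L 0 x - T) ∂((pinnedChain ω₂ lam β γ).gibbsMeasure L T)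 = ∫ u in Set.Ioi (0 : ℝ), ∫ z, (z.2 ⟨0, hL⟩ ^ 2 - T) * (∫ y, (y.2 ⟨0, hL⟩ ^ 2 - T) ∂((pinnedChain ω₂ lam β γ).transitionKernel L T T u.toNNReal z)) ∂((pinnedChain ω₂ lam β γ).gibbsMeasure L T) :=
  fun hω hl hβ hγ _ hL _ hT _ hC hL2 hmean hpde => greenKubo_forwardField hω hl hβ hγ hL hT hC hL2 hmean hpde

/-- Registered helper sub-goal `helper_plainKuboLinkOfResponseIdentity` (= `kuboLink_of_responseIdentity`):
the stub `stub_plainKuboLink` (vocabulary unfolded) from the route item `BoundaryEscapeDeficit.ResponseIdentity`. -/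
theorem helper_plainKuboLinkOfResponseIdentity : Summit.AtomisticToContinuum.FouriersLaw.Theses.BoundaryEscapeDeficit.ResponseIdentity → ∀ (ω₂ lam β γ : ℝ) (μ : (N : ℕ) → ℝ → ℝ → Measure (PhaseSpace N)) (T : ℝ) (D : ℕ → ℝ), 0 < ω₂ → 0 < lam → 0 < β → 0 < γ → 0 < T → (∀ (N : ℕ) (T_L T_R : ℝ), 0 < T_L → 0 < T_R → ∀ ρ ρ' : Measure (PhaseSpace N), (pinnedChain ω₂ lam β γ).IsSteadyState N T_L T_R ρ → (pinnedChain ω₂ lam β γ).IsSteadyState N T_L T_R ρ' → ρ = ρ') → (∀ (N : ℕ) (T_L T_R : ℝ), 0 < T_L → 0 < T_R → (pinnedChain ω₂ lam β γ).IsSteadyState N T_L T_R (μ N T_L T_R)) → (∀ N : ℕ, Tendsto (fun δ : ℝ => (pinnedChain ω₂ lam β γ).totalCurrent (μ N (T + δ / 2) (T - δ / 2)) / δ) (𝓝[≠] 0) (𝓝 (D N))) → (∀ N : ℕ, 2 ≤ N → 0 < D N) → ∀ L : ℕ, 2 ≤ L → ∀ g : PhaseSpace L → ℝ, ContDiff ℝ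 2 g → MemLp g 2 ((pinnedChain ω₂ lam β γ).gibbsMeasure L T) → ∫ x, g x ∂((pinnedChain ω₂ lam β γ).gibbsMeasure L T) = 0 → (∀ x, (pinnedChain ω₂ lam β γ).generator L T T g x = -(kin L 0 x - T)) → D L / ((L : ℝ) - 1) = γ * (1 - γ / T ^ 2 * ∫ x, g x * (kin L 0 x - T) ∂((pinnedChain ω₂ lam β γ).gibbsMeasure L T)) :=
  kuboLink_of_responseIdentity

end Summit.AtomisticToContinuum.FouriersLaw.Cruxes.SuperadditiveResistance.FloatingProbeBypassLaplacian

end
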